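import Summits.ResolutionOfSingularities.ResolutionOfSingularities.Theorems.LossEntryW11
import HarnessLib

/-!
# LossEntryW12 (= lens-3 g29 slice 6) — walk plumbing of the loss→entry law: the ORDINATE potential (first and last step of `lawLossEntryAt_of_wallSteps'`)

decomp-res-lens-3, gen 29 (NODE-g29 §3bis).  TOOL at 0.  Imports `Theorems.LossEntryW11` (landing part 11 = slice 5).

The g29 chain probe (398 genuine chain steps at (q,s) = (8,7), (8,6), 2- and 3-loss chains, F_2 and F_8) shows that the virtual-repeat
`β = x̂+ŷ−1` of the one-wall polygon RISES along chain losses while its ORDINATE `ŷ` never increases; so the skeleton to instantiate is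
`lawLossEntryAt_of_wallSteps'` (§17b, stated here: `LossEntryW11` landed before it was added) with `B v := ŷ_v`.  This slice proves its
first and last step for the (b) presentation:
* §18 `betaOf_entryPts_le_betaOf_of_axisWitness` — T8's E3 `ŷ ≤ β` with the survival hypothesis discharged by the axis witness
  (as in T8b), and `alphaOf_entryPts_lt_one_of_axisWitness`;
* §19 `wallOrdinate_le_runBeta_of_loss_b` — (h1'): after a (b)-loss at a heavy run state (no `Stays` hypothesis) the wall ordinate
  is `≤ β_t`; `runBeta_lt_wallOrdinate_of_loss_b` — (h3'): the proximity repeat reads `β_{t+2} = α'+ŷ−1 < ŷ` (`α' < 1` = axis law at `t+2`).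
* §20 `wallOrd` (the τ-straightened wall ordinate, τ read from the walk's own next move) and `runBeta_lt_wallOrd_of_repeat` —
  (h3') FOR EVERY wall state of a chain, with NO forcing lemma: `β_{v+2} < wallOrd W s (v+1) (j_v) (j_{v+1}) l'`
  (`polyPts_succ_chart_snd_translated` + the axis law at the run state `v+2`).
-/

open MvPolynomial Finset
open Literature.AlgebraicGeometry.Resolution
open Literature.AlgebraicGeometry.Resolution.Hauser2010
open Literature.AlgebraicGeometry.Resolution.PointBlowup
open Summit.ResolutionOfSingularities.ResolutionOfSingularities.Theorems.TightDefectClasses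
open Summit.ResolutionOfSingularities.ResolutionOfSingularities.Theorems.TightDefectStrongWalks
open Summit.ResolutionOfSingularities.ResolutionOfSingularities.Theorems.ItineraryCutClasses
open Summit.ResolutionOfSingularities.ResolutionOfSingularities.Theorems.BoundaryLedger
open Summit.ResolutionOfSingularities.ResolutionOfSingularities.Theorems.ProximityCut
open Summit.ResolutionOfSingularities.ResolutionOfSingularities.Theorems.LossExitCone
open Summit.ResolutionOfSingularities.ResolutionOfSingularities.Theorems.LossPolygon

/-! ## §17b The wall-step skeleton, ORDINATE form (strictness at the repeat) — the form the g29 chain probe selects (NODE-g29 §3bis) -/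

namespace Summit.ResolutionOfSingularities.ResolutionOfSingularities.Theorems.LossEpisode

open Summit.ResolutionOfSingularities.ResolutionOfSingularities.Theorems.LossPolygon

variable {K : Type} [Field K] [DecidableEq K] {q : ℕ} {s₀ : State (Fin 3) K}

section ChainSkeletonOrdinate

variable {W : ForcedWalk q s₀} {N s : ℕ}

/-- **THE WALL-STEP SKELETON, ORDINATE FORM (PROVED; the form the g29 chain probe selects, NODE-g29 §3bis):** as
`lawLossEntryAt_of_wallSteps` but with the strictness moved to the END — (h1) the loss at a heavy run state yields a `P`-state with
`B (t+1) ≤ β_t` (for `B` = the ordinate `ŷ` of the straightened one-wall polygon this is E3 `betaOf_entryPts_le_betaOf` transported);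
(h2) a loss move from a `P`-state yields a `P`-state and does not increase `B` (numerically exact in 217/217 genuine chain steps of
both types, NODE-g29 §3bis); (h3) the proximity repeat from a `P`-state lands in the run state of `lossMove_next` with `β < B` STRICTLY
(`β = α' + ŷ − 1` by `polyPts_clean_chart_snd` and `α' < 1` by the axis law at the wall state). [new] -/
theorem lawLossEntryAt_of_wallSteps' (hroot : IsRoot q s₀) (hT : TailHyp W N s) (P : ℕ → Prop) (B : ℕ → ℚ)
    (h1 : ∀ t : ℕ, N ≤ t → ∀ (i j l : Fin 3) (k m : ℕ), IsRunState W s t i j l k m → q ≤ m + s → IsLossMove W t →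
      P (t + 1) ∧ B (t + 1) ≤ runBeta W s t i j l)
    (h2 : ∀ v : ℕ, N < v → P v → IsLossMove W v → P (v + 1) ∧ B (v + 1) ≤ B v)
    (h3 : ∀ v : ℕ, N ≤ v → IsLossMove W v → StaysOnNewest W v → P (v + 1) → ∀ (l' : Fin 3) (d T : ℕ),
      IsRunState W s (v + 2) (W.j (v + 1)) (W.j v) l' d T → runBeta W s (v + 2) (W.j (v + 1)) (W.j v) l' < B (v + 1)) :
    LawLossEntryAt W N s := by
  intro t hNt i j l k m hS hm hloss
  obtain ⟨hP1, hB1⟩ := h1 t hNt i j l k m hS hm hloss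
  obtain ⟨w, htw, hlw, hsw, hrun⟩ := exists_stays_after_loss hroot hT hNt hloss
  have key : ∀ d : ℕ, t + d ≤ w → P (t + d + 1) ∧ B (t + d + 1) ≤ B (t + 1) := by
    intro d
    induction d with
    | zero => intro _; exact ⟨hP1, le_rfl⟩
    | succ d ih =>
      intro hd
      obtain ⟨hP, hB⟩ := ih (by omega)
      have hlx : IsLossMove W (t + d + 1) := by
        by_cases hx : t + d + 1 = w
        · rw [hx]; exact hlw
        · exact (hrun (t + d + 1) (by omega) (by omega)).1
      obtain ⟨hP', hB'⟩ := h2 (t + d + 1) (by omega) hP hlx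
      rw [show t + (d + 1) + 1 = t + d + 1 + 1 by omega]
      exact ⟨hP', hB'.trans hB⟩
  obtain ⟨hPw, hBw⟩ := key (w - t) (by omega)
  rw [show t + (w - t) + 1 = w + 1 by omega] at hPw hBw
  obtain ⟨T, -, -, -, hqT, hnext⟩ := lossMove_next hroot hT (by omega : N ≤ w) hlw
  rcases hnext with ⟨hnst, -, -⟩ | ⟨-, l', d, -, -, hTd, h1d, hS'⟩
  · exact absurd hsw hnst
  have hβ := h3 w (by omega) hlw hsw hPw l' d T hS'
  exact ⟨w + 2, by omega, _, _, _, _, _, hS', hqT.le, lt_of_lt_of_le hβ (hBw.trans hB1)⟩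


end ChainSkeletonOrdinate

end Summit.ResolutionOfSingularities.ResolutionOfSingularities.Theorems.LossEpisode

/-! ## §18 The ORDINATE form of the entry law (E3 with the survival hypothesis discharged): the first step (h1') of `lawLossEntryAt_of_wallSteps'` -/

namespace Summit.ResolutionOfSingularities.ResolutionOfSingularities.Theorems.LossPolygon

variable {K : Type} [Field K]

section EntryOrdinate

variable {i j l : Fin 3}

/-- **E3 WITH THE SURVIVAL HYPOTHESIS DISCHARGED (PROVED):** under the binders of `entry_lt_betaOf_of_axisWitness` (frame
`(j, i ; l)`, clean `F` of order `≥ o = r i + r j + s`, walls divide, `α < 1`, tail arithmetic, an axis witness `R` of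
`G = clean(σ_{i,j,φ} σ_{l,j,g} F)`), the entry ORDINATE is at most `β`: `betaOf (entryPts G) ≤ betaOf (polyPts F)`.
This is (h1') of `lawLossEntryAt_of_wallSteps'` at the polygon level (NODE-g29 §3bis: the ordinate `ŷ` of the one-wall polygon is
the potential that does not increase along loss chains; 398/398 chain steps). [T8 E3 + T8b; new] -/
theorem betaOf_entryPts_le_betaOf_of_axisWitness (hij : i ≠ j) (hil : i ≠ l) (hjl : j ≠ l) {q s : ℕ} {r : Fin 3 →₀ ℕ}
    (hrl : r l = 0) {φ : K} (hφ : φ ≠ 0) (g : K) {F : MvPolynomial (Fin 3) K}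
    (hclean : ∀ D ∈ F.support, ¬ IsPthPowerExponent q D) (hwall : ∀ D ∈ F.support, r ≤ D)
    (hdegF : ∀ D ∈ F.support, r i + r j + s ≤ D.degree) (hneF : (polyPts s r j i l F).Nonempty)
    (hα : alphaOf (polyPts s r j i l F) < 1) (hsq : s < q) (hqo : q < r i + r j + s) (hos : 2 * q + 1 ≤ r i + r j + s + s)
    {R : Fin 3 →₀ ℕ} (hR : R ∈ (deletePthPowers q (shear i j φ (shear l j g F))).support) (hax : R.degree + R l < 2 * q) :
    betaOf (entryPts s (r i + r j + s) i l (deletePthPowers q (shear i j φ (shear l j g F)))) ≤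
      betaOf (polyPts s r j i l F) := by
  classical
  have hos' : 2 * q ≤ r i + r j + s + s := by omega
  have hdegσ : ∀ E ∈ (shear i j φ (shear l j g F)).support, r i + r j + s ≤ E.degree := fun E hE =>
    le_degree_of_mem_support_shear hjl hij.symm hil.symm φ
      (fun E' hE' => le_degree_of_mem_support_shear hij.symm hjl hil g hdegF hE') hE
  have hRσ : R ∈ (shear i j φ (shear l j g F)).support := by
    have h := hR; rw [support_deletePthPowers'] at h; exact (Finset.mem_filter.mp h).1
  have hoR := hdegσ R hRσ
  have hRl : R l < s := by omega
  have hspos : 0 < s := by omega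
  have hε := alphaOf_entryPts_le_of_axisWitness (i := i) hos' hR hoR hax
  have hs : (0 : ℚ) < s := by exact_mod_cast hspos
  have hsurv : ∀ E ∈ (shear i j φ (shear l j g F)).support, E l < s →
      (entryPt s (r i + r j + s) i l E).1 =
        alphaOf (entryPts s (r i + r j + s) i l (deletePthPowers q (shear i j φ (shear l j g F)))) →
      ¬ IsPthPowerExponent q E := by
    intro E hE hEl hfst hP
    have hB := div_le_fst_entryPt_of_isPthPowerExponent hij hil hjl hsq hqo hP (hdegσ E hE) hEl (i := i)
    rw [hfst] at hB
    have := hB.trans hε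
    rw [div_le_div_iff_of_pos_right hs] at this
    linarith
  exact betaOf_entryPts_le_betaOf hij hil hjl hrl hφ g hclean hwall hneF hα hsurv
    ⟨_, entryPt_mem_entryPts s (r i + r j + s) i l _ hR hRl⟩

/-- **The entry ABSCISSA is below one (PROVED):** with an axis witness, `alphaOf (entryPts G) < 1` — the new wall state's
`α' < 1`, the source of STRICTNESS in (h3') of `lawLossEntryAt_of_wallSteps'`. [T8b; new] -/
theorem alphaOf_entryPts_lt_one_of_axisWitness {q s o : ℕ} (hos : 2 * q ≤ o + s) (hspos : 0 < s)
    {G : MvPolynomial (Fin 3) K} {R : Fin 3 →₀ ℕ} (hR : R ∈ G.support) (hoR : o ≤ R.degree) (hax : R.degree + R l < 2 * q) :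
    alphaOf (entryPts s o i l G) < 1 := by
  refine lt_of_le_of_lt (alphaOf_entryPts_le_of_axisWitness (i := i) hos hR hoR hax) ?_
  have hs : (0 : ℚ) < s := by exact_mod_cast hspos
  rw [div_lt_one hs]
  have : ((2 * q : ℕ) : ℚ) ≤ ((o : ℕ) : ℚ) + s := by exact_mod_cast hos
  linarith

end EntryOrdinate

end Summit.ResolutionOfSingularities.ResolutionOfSingularities.Theorems.LossPolygon

/-! ## §19 (h1') and (h3') for the first wall state after a (b)-loss: the wall ORDINATE is at most `β_t`, and the repeat reads `β_{t+2} < ŷ` -/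

namespace Summit.ResolutionOfSingularities.ResolutionOfSingularities.Theorems.LossEpisode

open Summit.ResolutionOfSingularities.ResolutionOfSingularities.Theorems.LossPolygon

variable {K : Type} [Field K] [DecidableEq K] {q : ℕ} {s₀ : State (Fin 3) K}

section WallOrdinateB

variable {W : ForcedWalk q s₀} {N s : ℕ}

/-- **(h1') FOR THE (b) PRESENTATION (PROVED):** after a loss move in the chart of the RUN wall (`j_t = j`, translated,
`b_t(i) ≠ 0`) at a heavy run state, the ORDINATE of the one-wall polygon of the new state (frame: wall `j`, section `i`,
ceiling `l` — a straight wall state) is at most `β_t`.  No `StaysOnNewest` hypothesis: this is the first step of a loss CHAIN as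
well. [NODE-g29 §3bis (iii); new] -/
theorem wallOrdinate_le_runBeta_of_loss_b (hroot : IsRoot q s₀) (hT : TailHyp W N s) {t : ℕ} (hNt : N ≤ t) {i j l : Fin 3}
    {k m : ℕ} (hS : IsRunState W s t i j l k m) (hm : q ≤ m + s) (hjt : W.j t = j) (hbi : W.b t i ≠ 0)
    (hloss : IsLossMove W t) :
    betaOf (polyPts s (W.st (t + 1)).r j i l (W.st (t + 1)).F) ≤ runBeta W s t i j l := by
  classical
  obtain ⟨hord, hq, hks, hms, -⟩ := runState_ledger hroot hT hNt hS
  obtain ⟨hri, hrj, hrl⟩ := hS.r_apply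
  have hij : i ≠ j := hS.1
  have hli : l ≠ i := hS.2.1
  have hlj : l ≠ j := hS.2.2.1
  have hsq : s < q := hT.s_lt
  have h1s : 1 ≤ s := hT.one_le
  obtain ⟨T, hoT, h1T, hr1, hqT, -⟩ := lossMove_next hroot hT hNt hloss
  have hTo : q + T = k + m + s := by
    have h := hord.symm.trans hoT
    have h' : s + k + m = q + T := by exact_mod_cast h
    omega
  rw [hjt] at hr1
  have hP1 := polyPts_succ_loss_b hroot t hS hjt hr1 hTo
  have hos : 2 * q + 1 ≤ k + m + s + s := by omega
  obtain ⟨R, hR, hax, hRl⟩ := exists_axisWitness_loss_b hroot hT hNt hS hjt hos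
  have hqj : q ≤ s + (W.st t).r j := by rw [hrj]; omega
  have h8 := betaOf_entryPts_le_betaOf_of_axisWitness hij hli.symm (Ne.symm hlj) hrl hbi (W.b t l)
    (fun D hD => not_isPthPowerExponent_of_mem_support hroot W t hD) (walk_r hroot W t)
    (fun D hD => by rw [hri, hrj]; exact le_degree_of_mem_support_runState hroot hT hNt hS hD)
    (polyPts_nonempty_of_heavy_fst hroot W t (Ne.symm hlj) i hqj hrl)
    (alphaOf_polyPts_lt_one hroot W t (Ne.symm hlj) i hqj hrl) hsq (by rw [hri, hrj]; omega) (by rw [hri, hrj]; omega)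
    hR hax
  rw [hri, hrj] at h8
  unfold runBeta
  rw [hP1]
  exact h8

/-- **(h3') FOR A STRAIGHT WALL STATE REACHED BY A (b)-LOSS (PROVED):** if the loss IS followed by its proximity repeat, the
repeat's run state `t+2` reads `β_{t+2} = α' + ŷ − 1 < ŷ` where `(α', ŷ)` is the vertex of the one-wall polygon at `t+1` and
`α' < 1` is the axis law at the run state `t+2` — the STRICT last step of `lawLossEntryAt_of_wallSteps'`. [NODE-g29 §3bis (iv); new] -/
theorem runBeta_lt_wallOrdinate_of_loss_b (hroot : IsRoot q s₀) (hT : TailHyp W N s) {t : ℕ} (hNt : N ≤ t) {i j l : Fin 3}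
    {k m : ℕ} (hS : IsRunState W s t i j l k m) (hjt : W.j t = j) (hbi : W.b t i ≠ 0)
    (hloss : IsLossMove W t) (hst : StaysOnNewest W t) :
    ∃ (d T : ℕ), IsRunState W s (t + 1 + 1) i j l d T ∧ q ≤ T + s ∧
      runBeta W s (t + 1 + 1) i j l < betaOf (polyPts s (W.st (t + 1)).r j i l (W.st (t + 1)).F) := by
  classical
  obtain ⟨hord, hq, hks, hms, -⟩ := runState_ledger hroot hT hNt hS
  obtain ⟨hri, hrj, hrl⟩ := hS.r_apply
  have hij : i ≠ j := hS.1
  have hli : l ≠ i := hS.2.1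
  have hlj : l ≠ j := hS.2.2.1
  have hsq : s < q := hT.s_lt
  have h1s : 1 ≤ s := hT.one_le
  obtain ⟨T, hoT, h1T, hr1, hqT, hnext⟩ := lossMove_next hroot hT hNt hloss
  have hTo : q + T = k + m + s := by
    have h := hord.symm.trans hoT
    have h' : s + k + m = q + T := by exact_mod_cast h
    omega
  rcases hnext with ⟨hnst, -, -⟩ | ⟨-, l₂, d, hl₂i, hl₂j, hTd, h1d, hS2⟩
  · exact absurd hst hnst
  obtain ⟨hci, hb1⟩ := repeat_after_loss_b hroot hT hNt hS hjt hbi hloss hst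
  rw [hci] at hS2 hl₂i
  rw [hjt] at hS2 hl₂j hr1
  have hl₂ : l₂ = l := by
    rcases fin3_eq_or i j l l₂ hij hli.symm (Ne.symm hlj) with h | h | h
    · exact absurd h hl₂i
    · exact absurd h hl₂j
    · exact h
  rw [hl₂] at hS2
  have hS2' : IsRunState W s (t + 1 + 1) i j l d T := hS2
  refine ⟨d, T, hS2', hqT.le, ?_⟩
  obtain ⟨hr₂i, hr₂j, hr₂l⟩ := hS2'.r_apply
  have hr₁j : (W.st (t + 1)).r j = T := by rw [hr1, Finsupp.single_eq_same]
  have hr₁i : (W.st (t + 1)).r i = 0 := by rw [hr1, Finsupp.single_apply, if_neg hij.symm]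
  have hr₁l : (W.st (t + 1)).r l = 0 := by rw [hr1, Finsupp.single_apply, if_neg (Ne.symm hlj)]
  have hP2 : polyPts s (W.st (t + 1 + 1)).r j i l (W.st (t + 1 + 1)).F =
      (polyPts s (W.st (t + 1)).r j i l (W.st (t + 1)).F).image psi01 :=
    polyPts_succ_chart_snd hroot W (t + 1) hij.symm (Ne.symm hlj) (Ne.symm hli) hci hb1 (by rw [hr₂j, hr₁j])
      (by rw [hr₂i, hr₁j, hr₁i]; omega) hr₁l hr₂l
  have hne1 : (polyPts s (W.st (t + 1)).r j i l (W.st (t + 1)).F).Nonempty :=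
    polyPts_nonempty_of_heavy_fst hroot W (t + 1) (Ne.symm hlj) i (by rw [hr₁j]; omega) hr₁l
  -- `α' < 1` at the run state `t+2` (axis law; first letter `j`, wall `T`, heavy `q ≤ s + T`), read back on the wall polygon
  have hqT' : q ≤ s + (W.st (t + 1 + 1)).r j := by rw [hr₂j]; omega
  have hα2 := alphaOf_polyPts_lt_one hroot W (t + 1 + 1) (Ne.symm hlj) i hqT' hr₂l
  rw [hP2, alphaOf_image_psi01 hne1] at hα2
  unfold runBeta
  rw [hP2]
  exact (betaOf_image_psi01_lt_iff hne1).mpr hα2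

end WallOrdinateB

end Summit.ResolutionOfSingularities.ResolutionOfSingularities.Theorems.LossEpisode

/-! ## §20 (h3') IN GENERAL: the proximity repeat from ANY wall state of the chain reads `β < ŷ^τ` — no forcing lemma needed (NODE-g29 §3bis N1) -/

namespace Summit.ResolutionOfSingularities.ResolutionOfSingularities.Theorems.LossEpisode

open Summit.ResolutionOfSingularities.ResolutionOfSingularities.Theorems.LossPolygon

variable {K : Type} [Field K] [DecidableEq K] {q : ℕ} {s₀ : State (Fin 3) K}

section WallOrdinateRepeat

variable {W : ForcedWalk q s₀} {N s : ℕ}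

/-- **THE τ-STRAIGHTENED WALL ORDINATE.**  `wallOrd W s v a b c` = the ordinate `ŷ` of the lex-min vertex of the one-wall polygon of
state `v` in the frame (wall `a`, section `b`; ceiling `c`) AFTER the straightening `u_c ↦ u_c + τ u_b` by the translation
`τ = b_v(c)` of the walk's OWN next move — the potential `B` of `lawLossEntryAt_of_wallSteps'` read from the walk's future
(NODE-g29 §3bis (N1)). DEFINITION (support). [new] -/
noncomputable def wallOrd (W : ForcedWalk q s₀) (s v : ℕ) (a b c : Fin 3) : ℚ :=
  betaOf (polyPts s (W.st v).r a b c (deletePthPowers q (shear c b (W.b v c) (W.st v).F)))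

/-- **(h3') FOR EVERY WALL STATE (PROVED, no forcing):** if the loss move at `v ≥ N` is followed by a proximity repeat
(`StaysOnNewest W v`: chart `j_{v+1} ≠ j_v`, no translation along the wall letter) landing in the run state
`IsRunState W s (v+2) (j_{v+1}) (j_v) l' d T`, then `β_{v+2} < wallOrd W s (v+1) (j_v) (j_{v+1}) l'` STRICTLY:
`P_{v+2} = Ψ₍₀:₁₎(P^τ_{v+1})` (`polyPts_succ_chart_snd_translated` with the repeat's own translation `τ = b_{v+1}(l')`), so
`β_{v+2} = α_{v+2} + ŷ^τ − 1`, and `α_{v+2} < 1` is the axis law at the run state `v+2`.  This is hypothesis (h3) of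
`lawLossEntryAt_of_wallSteps'` for `B (v+1) := wallOrd W s (v+1) (j_v) (j_{v+1}) l'`, discharged once and for all. [new] -/
theorem runBeta_lt_wallOrd_of_repeat (hroot : IsRoot q s₀) (hT : TailHyp W N s) {v : ℕ} (hNv : N ≤ v)
    (hloss : IsLossMove W v) (hst : StaysOnNewest W v) {l' : Fin 3} {d T : ℕ}
    (hS' : IsRunState W s (v + 2) (W.j (v + 1)) (W.j v) l' d T) :
    runBeta W s (v + 2) (W.j (v + 1)) (W.j v) l' < wallOrd W s (v + 1) (W.j v) (W.j (v + 1)) l' := by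
  classical
  obtain ⟨T₀, -, -, hr1, hqT₀, hnext⟩ := lossMove_next hroot hT hNv hloss
  rcases hnext with ⟨hnst, -, -⟩ | ⟨-, l₂, d₂, -, -, hTd₂, -, hS₂⟩
  · exact absurd hst hnst
  -- letters
  have hba : W.j (v + 1) ≠ W.j v := hS'.1
  have hlb : l' ≠ W.j (v + 1) := hS'.2.1
  have hla : l' ≠ W.j v := hS'.2.2.1
  -- masses: `T = T₀`, `d + q = s + T`
  obtain ⟨hr₂b, hr₂a, hr₂l⟩ := hS'.r_apply
  obtain ⟨hr₂b', hr₂a', -⟩ := hS₂.r_apply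
  have hTT : T = T₀ := by rw [hr₂a] at hr₂a'; exact hr₂a'
  have hdd : d = d₂ := by rw [hr₂b] at hr₂b'; exact hr₂b'
  have hr₁a : (W.st (v + 1)).r (W.j v) = T₀ := by rw [hr1, Finsupp.single_eq_same]
  have hr₁b : (W.st (v + 1)).r (W.j (v + 1)) = 0 := by rw [hr1, Finsupp.single_apply, if_neg hba.symm]
  have hr₁l : (W.st (v + 1)).r l' = 0 := by rw [hr1, Finsupp.single_apply, if_neg hla.symm]
  -- the repeat's translation: zero along the wall letter (Stays) and along its own chart letter (onExc)
  have hb : ∀ w, w ≠ l' → W.b (v + 1) w = 0 := by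
    intro w hw
    rcases fin3_eq_or (W.j (v + 1)) (W.j v) l' w hba hlb.symm hla.symm with h | h | h
    · rw [h]; exact W.onExc (v + 1)
    · rw [h]; exact hst.2
    · exact absurd h hw
  have hP2 : polyPts s (W.st (v + 1 + 1)).r (W.j v) (W.j (v + 1)) l' (W.st (v + 1 + 1)).F =
      (polyPts s (W.st (v + 1)).r (W.j v) (W.j (v + 1)) l'
        (deletePthPowers q (shear l' (W.j (v + 1)) (W.b (v + 1) l') (W.st (v + 1)).F))).image psi01 :=
    polyPts_succ_chart_snd_translated hroot W (v + 1) hba.symm hla.symm hlb.symm rfl hb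
      (by rw [hr₂a, hr₁a, hTT]) (by rw [hr₂b, hr₁a, hr₁b, hdd]; omega) hr₁l hr₂l
  -- `α_{v+2} < 1` (axis law at the run state `v+2`, first letter `j_v` with wall `T`, heavy)
  have hq2 : q ≤ s + (W.st (v + 1 + 1)).r (W.j v) := by rw [hr₂a, hTT]; omega
  have hne2 : (polyPts s (W.st (v + 1 + 1)).r (W.j v) (W.j (v + 1)) l' (W.st (v + 1 + 1)).F).Nonempty :=
    polyPts_nonempty_of_heavy_fst hroot W (v + 1 + 1) hla.symm (W.j (v + 1)) hq2 hr₂l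
  have hne1 : (polyPts s (W.st (v + 1)).r (W.j v) (W.j (v + 1)) l'
      (deletePthPowers q (shear l' (W.j (v + 1)) (W.b (v + 1) l') (W.st (v + 1)).F))).Nonempty := by
    rw [hP2] at hne2; exact Finset.image_nonempty.mp hne2
  have hα2 := alphaOf_polyPts_lt_one hroot W (v + 1 + 1) hla.symm (W.j (v + 1)) hq2 hr₂l
  rw [hP2, alphaOf_image_psi01 hne1] at hα2
  unfold runBeta wallOrd
  rw [hP2]
  exact (betaOf_image_psi01_lt_iff hne1).mpr hα2

end WallOrdinateRepeat

end Summit.ResolutionOfSingularities.ResolutionOfSingularities.Theorems.LossEpisode
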